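import Summits.PneNP.PneNP.Theorems.SliceACZero.Negative.LoadBearingHyp
import Literature.Computability.Complexity.RossmanMonotoneCliqueProofs

/-!
# `SliceACZero` (stmt-PneNP-2835) — negative-side lemmas II: the clique size must exceed the exponent

`not_innerConc_of_le`, `not_innerHyp_of_le`: for depth `d ≥ 2` and `k ≤ c` the GENUINE inner clauses of
the crux are false for EVERY `δ ≥ 0` (the exhaustive clique DNF `exists_cliqueDNF_monotoneAC`:
`acDepth ≤ 2`, `≤ C(n,k)+1 ≤ n^c` gates, exact); hence every witness has `c < k` (`lt_of_innerConc`,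
`lt_of_innerHyp`) and the `∀ c ∀ k` strengthenings ("one exponent for all clique sizes") are false
(`not_concForallK`, `not_hypForallK`). A proof of the crux must let `k` grow with `c` (Rossman 2008 /
Amano 2010: size `n^{k/4+O(1)}` suffices on average, so in truth `k ≳ 4c`).

Refuter seat cdisprove-stmt-PneNP-2835 (gen 1), 2026-08-16. In the docstrings, `InnerConc d c k δ` /
`InnerHyp d c k δ` (and their `NoWindow`/`NoBasis`/… variants) denote the displayed inner clauses; they are
named predicates only in the work file `Summits/PneNP/PneNP/Cruxes/SliceACZero/Disproof.lean` (running
commentary: why the crux resists, what was not attempted) and are INLINED here.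
-/

noncomputable section

namespace Summit.PneNP.PneNP.Theorems.SliceACZero.Negative

open Literature.Computability.Complexity Filter Finset
open Summit.PneNP.PneNP.Theses.OneSlice (SliceACZero)

/-! ## Part II — order of quantifiers: the clique size `k` must exceed the exponent `c`

The inner clause at fixed `(d, c, k, δ)` is FALSE whenever `d ≥ 2` and `k ≤ c`, for every `δ ≥ 0`:
the exhaustive clique DNF `⋁_{|A|=k} ⋀_{e ⊆ A} x_e` (in tree: `exists_cliqueDNF_monotoneAC`) is an
`acBasis` circuit of `acDepth ≤ 2`, size `≤ C(n,k) + 1 ≤ n^k ≤ n^c`, exact on every slice and at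
every density. Hence the witness `k` of `Conc d c` satisfies `k > c` (`lt_of_innerConc`); the natural
strengthening "one exponent works for every `k ≥ 3`" is false (`not_concForallK`); by the
Rossman/Amano average-case upper bound `n^{k/4+O(1)}` (not vendored for AC⁰ on slices) the true
requirement is `k ≳ 4c`. The same holds verbatim for `Hyp`. -/

/-- The exhaustive clique DNF as an `acBasis` circuit of `acDepth ≤ 2` (from the in-tree
`exists_cliqueDNF_monotoneAC`, Alon–Boppana 1987 §3). [cite: AlonBoppana1987, §3] -/
theorem exists_cliqueDNF (n k : ℕ) :
    ∃ C : Circuit ((⊤ : SimpleGraph (Fin n)).edgeSet), C.IsOver acBasis ∧ C.acDepth ≤ 2 ∧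
      C.size ≤ n.choose k + 1 ∧ ∀ x, C.eval x = cliqueFn n k x := by
  obtain ⟨C, hB, hd, hs, hE⟩ := exists_cliqueDNF_monotoneAC n k
  exact ⟨C, hB.mono monotoneACBasis_subset_acBasis, (acDepth_le_depth C).trans hd, hs, hE⟩

/-- For `n ≥ 2` and `2 ≤ k ≤ c` the exhaustive DNF has at most `n^c` gates. [folklore] -/
theorem choose_succ_le_pow {n k c : ℕ} (hn : 2 ≤ n) (hk : 2 ≤ k) (hkc : k ≤ c) :
    n.choose k + 1 ≤ n ^ c :=
  Nat.succ_le_of_lt ((Nat.choose_lt_pow (by omega) hk).trans_le (Nat.pow_le_pow_right (by omega) hkc))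

/-- **`k ≤ c` is impossible in `Conc` (depth ≥ 2)**: the inner clause fails for every `δ ≥ 0`,
witnessed on the central slice `j = m_k(n)` by the exhaustive clique DNF. [folklore] -/
theorem not_innerConc_of_le {d c k : ℕ} (hd : 2 ≤ d) (hk : 2 ≤ k) (hkc : k ≤ c) {δ : ℝ}
    (hδ : 0 ≤ δ) : ¬ (∀ᶠ n : ℕ in atTop, ∀ j : ℕ, |(j : ℝ) - (mk n k : ℝ)| ≤ (mk n k : ℝ) ^ ((3 : ℝ) / 4) →
        ∀ C : Circuit ((⊤ : SimpleGraph (Fin n)).edgeSet), C.IsOver acBasis → C.acDepth ≤ d →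
          (sliceErr n j C.eval (cliqueFn n k) : ℝ) ≤ δ * sliceCard n j → n ^ c < C.size) := by
  intro h
  obtain ⟨n, hn, hn2⟩ := (h.and (eventually_ge_atTop 2)).exists
  obtain ⟨C, hB, hD, hS, hE⟩ := exists_cliqueDNF n k
  have herr : (sliceErr n (mk n k) C.eval (cliqueFn n k) : ℝ) ≤ δ * sliceCard n (mk n k) := by
    rw [sliceErr_eq_zero_of_forall _ hE, Nat.cast_zero]
    exact mul_nonneg hδ (Nat.cast_nonneg _)
  have hlt := hn (mk n k) (centre_count n k) C hB (hD.trans hd) herr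
  exact absurd (hS.trans (choose_succ_le_pow hn2 hk hkc)) (not_le.2 hlt)

/-- **`k ≤ c` is impossible in `Hyp` (depth ≥ 2)** likewise, at the central density. [folklore] -/
theorem not_innerHyp_of_le {d c k : ℕ} (hd : 2 ≤ d) (hk : 2 ≤ k) (hkc : k ≤ c) {δ : ℝ}
    (hδ : 0 ≤ δ) : ¬ (∀ᶠ n : ℕ in atTop, ∀ q : ℝ, 0 ≤ q → q ≤ 1 →
        |q * (n.choose 2 : ℕ) - (mk n k : ℝ)| ≤ (mk n k : ℝ) ^ ((3 : ℝ) / 4) →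
        ∀ C : Circuit ((⊤ : SimpleGraph (Fin n)).edgeSet), C.IsOver acBasis → C.acDepth ≤ d →
          gnpDisagreeProb n q C.eval (cliqueFn n k) ≤ δ → n ^ c < C.size) := by
  intro h
  obtain ⟨n, hn, hn2⟩ := (h.and (eventually_ge_atTop 2)).exists
  obtain ⟨C, hB, hD, hS, hE⟩ := exists_cliqueDNF n k
  obtain ⟨hq0, hq1, hqw⟩ := centre_density hn2 hk
  have herr : gnpDisagreeProb n ((mk n k : ℝ) / (n.choose 2 : ℕ)) C.eval (cliqueFn n k) ≤ δ := by
    rw [gnpDisagreeProb_eq_zero_of_forall _ hE]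
    exact hδ
  have hlt := hn _ hq0 hq1 hqw C hB (hD.trans hd) herr
  exact absurd (hS.trans (choose_succ_le_pow hn2 hk hkc)) (not_le.2 hlt)

/-- Any witness `k ≥ 2` of `Conc` at depth `d ≥ 2` exceeds the exponent: `c < k`. [folklore] -/
theorem lt_of_innerConc {d c k : ℕ} (hd : 2 ≤ d) (hk : 2 ≤ k) {δ : ℝ} (hδ : 0 ≤ δ)
    (h : (∀ᶠ n : ℕ in atTop, ∀ j : ℕ, |(j : ℝ) - (mk n k : ℝ)| ≤ (mk n k : ℝ) ^ ((3 : ℝ) / 4) →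
        ∀ C : Circuit ((⊤ : SimpleGraph (Fin n)).edgeSet), C.IsOver acBasis → C.acDepth ≤ d →
          (sliceErr n j C.eval (cliqueFn n k) : ℝ) ≤ δ * sliceCard n j → n ^ c < C.size)) : c < k :=
  lt_of_not_ge fun hkc => not_innerConc_of_le hd hk hkc hδ h

/-- Any witness `k ≥ 2` of `Hyp` at depth `d ≥ 2` exceeds the exponent: `c < k`. [folklore] -/
theorem lt_of_innerHyp {d c k : ℕ} (hd : 2 ≤ d) (hk : 2 ≤ k) {δ : ℝ} (hδ : 0 ≤ δ)
    (h : (∀ᶠ n : ℕ in atTop, ∀ q : ℝ, 0 ≤ q → q ≤ 1 →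
        |q * (n.choose 2 : ℕ) - (mk n k : ℝ)| ≤ (mk n k : ℝ) ^ ((3 : ℝ) / 4) →
        ∀ C : Circuit ((⊤ : SimpleGraph (Fin n)).edgeSet), C.IsOver acBasis → C.acDepth ≤ d →
          gnpDisagreeProb n q C.eval (cliqueFn n k) ≤ δ → n ^ c < C.size)) : c < k :=
  lt_of_not_ge fun hkc => not_innerHyp_of_le hd hk hkc hδ h

/-- **The `∀ c ∀ k` strengthening of `Conc` is false** ("one exponent for all clique sizes";
`d = 2`, `c = k = 3`: the triangle DNF has `≤ C(n,3)+1 ≤ n^3` gates). [folklore] -/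
theorem not_concForallK :
    ¬ ∀ d c : ℕ, ∀ k : ℕ, 3 ≤ k → ∃ δ : ℝ, 0 < δ ∧ (∀ᶠ n : ℕ in atTop, ∀ j : ℕ, |(j : ℝ) - (mk n k : ℝ)| ≤ (mk n k : ℝ) ^ ((3 : ℝ) / 4) →
        ∀ C : Circuit ((⊤ : SimpleGraph (Fin n)).edgeSet), C.IsOver acBasis → C.acDepth ≤ d →
          (sliceErr n j C.eval (cliqueFn n k) : ℝ) ≤ δ * sliceCard n j → n ^ c < C.size) := fun h => by
  obtain ⟨δ, hδ, hI⟩ := h 2 3 3 le_rfl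
  exact not_innerConc_of_le le_rfl (by norm_num) le_rfl hδ.le hI

/-- **The `∀ c ∀ k` strengthening of `Hyp` is false** (same witness at the central density).
[folklore] -/
theorem not_hypForallK :
    ¬ ∀ d c : ℕ, ∀ k : ℕ, 3 ≤ k → ∃ δ : ℝ, 0 < δ ∧ (∀ᶠ n : ℕ in atTop, ∀ q : ℝ, 0 ≤ q → q ≤ 1 →
        |q * (n.choose 2 : ℕ) - (mk n k : ℝ)| ≤ (mk n k : ℝ) ^ ((3 : ℝ) / 4) →
        ∀ C : Circuit ((⊤ : SimpleGraph (Fin n)).edgeSet), C.IsOver acBasis → C.acDepth ≤ d →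
          gnpDisagreeProb n q C.eval (cliqueFn n k) ≤ δ → n ^ c < C.size) := fun h => by
  obtain ⟨δ, hδ, hI⟩ := h 2 3 3 le_rfl
  exact not_innerHyp_of_le le_rfl (by norm_num) le_rfl hδ.le hI

end Summit.PneNP.PneNP.Theorems.SliceACZero.Negative

end
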